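import Summits.CriticalPhenomena.PercolationContinuityZ3.Theorems.Transplant.FKDoubleFanWordCellsParts
import Summits.CriticalPhenomena.PercolationContinuityZ3.Theorems.Transplant.FKDoubleFanMultifanGens
import HarnessLib

/-!
# Double fans `K₂ ∨ P_{m+1}`, cells of a two-block middle pattern: the MIRROR symmetry of the polarized cells

Helper file (`--supports stmt-CriticalPhenomena-4575`), FK sub-lane `prim-bschramm-fk-3` (gen 49); builds on p205010 (kernel theorem, internal
audit signed; external expert review pending).  Pure real algebra; no named facts, no sorries; standard axioms.  Memo
`bschramm/prim-bschramm-fk-3/FAR-CROSS-XXIV.md` §3.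

The apex swap `a ↔ b` of the double fan is the hat relabelling `y ↔ z` on bivectors (`Biv.swapYZ` of `…MultifanGens`).  It exchanges the
input and target bivectors of a product vector (**`swapYZ_inputBiv`**, **`swapYZ_targetBiv`**), exchanges the spoke letters
(**`swapYZ_opAC`**, **`swapYZ_opBC`**) and commutes with the rim letters (**`swapYZ_opTD`**, **`swapYZ_opWD`**, **`swapYZ_rimOp`**); together with the
self-adjointness of all letters for `pairH` this gives the **mirror identity** (**`pcell2_mirror`**)
`pcell2 q k0 k1 k2 x1 y1 x2 y2 P S = pcell2 q k2 k1 k0 y2 x2 y1 x1 S P`: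
reversing the word, exchanging the roles of the spokes and of the two product vectors.  Hence (**`partsOK_mirror`**) the parts condition of the
word `(k0,k1,k2)` with spokes `(x1,y1,x2,y2)` is the parts condition of `(k2,k1,k0)` with spokes `(y2,x2,y1,x1)` — for the MIN pattern
`PartsOK q k0 k1 k2 0 y x 0 ↔ PartsOK q k2 k1 k0 0 x y 0` (**`partsOK_mirror_min`**), which halves the certificate campaign.
[folklore]
-/

noncomputable section

namespace Summit.CriticalPhenomena.PercolationContinuityZ3.Theorems

namespace FK

namespace ThreeApex

/-! ### The mirror on the building blocks -/

/-- The mirror of an input bivector is the target bivector of the same product vector. [folklore] -/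
theorem swapYZ_inputBiv (P : P6) : Biv.swapYZ (inputBiv P) = targetBiv P := by
  ext <;> simp [Biv.swapYZ, inputBiv, targetBiv]

/-- The mirror of a target bivector is the input bivector of the same product vector. [folklore] -/
theorem swapYZ_targetBiv (S : P6) : Biv.swapYZ (targetBiv S) = inputBiv S := by
  ext <;> simp [Biv.swapYZ, inputBiv, targetBiv]

/-- The mirror is an involution. [folklore] -/
theorem swapYZ_swapYZ (β : Biv) : Biv.swapYZ (Biv.swapYZ β) = β := by
  ext <;> simp [Biv.swapYZ]

set_option linter.unnecessarySeqFocus false in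
/-- The mirror exchanges the spoke letters: `σ ∘ ∧²AC_x = ∧²BC_x ∘ σ`. [folklore] -/
theorem swapYZ_opAC (x : ℝ) (β : Biv) : Biv.swapYZ (opAC x β) = opBC x (Biv.swapYZ β) := by
  ext <;> simp only [Biv.swapYZ, opAC, opBC, opTa, opWa, opTb, opWb, Biv.lin3, Biv.add, Biv.smul] <;> ring

set_option linter.unnecessarySeqFocus false in
/-- The mirror exchanges the spoke letters: `σ ∘ ∧²BC_y = ∧²AC_y ∘ σ`. [folklore] -/
theorem swapYZ_opBC (y : ℝ) (β : Biv) : Biv.swapYZ (opBC y β) = opAC y (Biv.swapYZ β) := by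
  ext <;> simp only [Biv.swapYZ, opAC, opBC, opTa, opWa, opTb, opWb, Biv.lin3, Biv.add, Biv.smul] <;> ring

/-- The mirror commutes with the polarisation `T_D`. [folklore] -/
theorem swapYZ_opTD (q : ℝ) (β : Biv) : Biv.swapYZ (opTD q β) = opTD q (Biv.swapYZ β) := by
  ext <;> simp only [Biv.swapYZ, opTD] <;> ring

/-- The mirror commutes with `W_D`. [folklore] -/
theorem swapYZ_opWD (q : ℝ) (β : Biv) : Biv.swapYZ (opWD q β) = opWD q (Biv.swapYZ β) := by
  ext <;> simp only [Biv.swapYZ, opWD, formD] <;> ring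

/-- The mirror commutes with every rim letter. [folklore] -/
theorem swapYZ_rimOp (q : ℝ) (k : ℕ) (β : Biv) : Biv.swapYZ (rimOp q k β) = rimOp q k (Biv.swapYZ β) := by
  match k with
  | 0 => exact swapYZ_opWD q β
  | 1 => exact swapYZ_opTD q β
  | _ + 2 => rfl

/-- The rim letters are self-adjoint for `pairH`. [folklore] -/
theorem pairH_rimOp (q : ℝ) (k : ℕ) (β γ : Biv) : pairH q (rimOp q k β) γ = pairH q β (rimOp q k γ) := by
  match k with
  | 0 => exact pairH_opWD q β γ
  | 1 => exact pairH_opTD q β γ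
  | _ + 2 => rfl

/-! ### The mirror identity -/

/-- `pairH` is invariant under mirroring both arguments. [folklore] -/
theorem pairH_swapYZ_swapYZ (q : ℝ) (β γ : Biv) : pairH q (Biv.swapYZ β) (Biv.swapYZ γ) = pairH q β γ := by
  rw [pairH_swapYZ, swapYZ_swapYZ, pairH_comm]

/-- **Mirror identity of the polarized cells**: `pcell2 q k0 k1 k2 x1 y1 x2 y2 P S = pcell2 q k2 k1 k0 y2 x2 y1 x1 S P`. [folklore] -/
theorem pcell2_mirror (q : ℝ) (k0 k1 k2 : ℕ) (x1 y1 x2 y2 : ℝ) (P S : P6) :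
    pcell2 q k0 k1 k2 x1 y1 x2 y2 P S = pcell2 q k2 k1 k0 y2 x2 y1 x1 S P := by
  unfold pcell2
  -- left: move the word onto the target by self-adjointness
  conv_lhs => rw [pairH_rimOp, pairH_opAC, pairH_opBC, pairH_rimOp, pairH_opAC, pairH_opBC, pairH_rimOp]
  -- right: write both bivectors as mirrors and push the mirror through the word
  conv_rhs => rw [← swapYZ_targetBiv S, ← swapYZ_inputBiv P]; simp only [← swapYZ_rimOp, ← swapYZ_opAC, ← swapYZ_opBC]
  conv_rhs => rw [pairH_swapYZ_swapYZ, pairH_comm]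

/-- The generators are mirror-neutral, so **the parts condition is mirror symmetric**. [folklore] -/
theorem partsOK_mirror {q : ℝ} {k0 k1 k2 : ℕ} {x1 y1 x2 y2 : ℝ} (H : PartsOK q k2 k1 k0 y2 x2 y1 x1) :
    PartsOK q k0 k1 k2 x1 y1 x2 y2 := by
  intro P S hP hS
  rw [pcell2_mirror]
  exact H S P hS hP

/-- **MIN pattern**: `PartsOK q k2 k1 k0 0 x y 0 → PartsOK q k0 k1 k2 0 y x 0`. [folklore] -/
theorem partsOK_mirror_min {q : ℝ} {k0 k1 k2 : ℕ} {y x : ℝ} (H : PartsOK q k2 k1 k0 0 x y 0) : PartsOK q k0 k1 k2 0 y x 0 :=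
  partsOK_mirror H

end ThreeApex

end FK

end Summit.CriticalPhenomena.PercolationContinuityZ3.Theorems
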